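import Literature.IUT.HodgeArakelov.AbsTopInterfaces
import Literature.IUT.HodgeArakelov.GaloisPairRigidity
import Literature.IUT.HodgeArakelov.KummerStructures

/-!
# [IUTchII] §1, Example 1.8 (ix): the log-shell `I(G) ⊆ O^{×μ}(G)` — PROOFS at the interface level

Proof-only companion (abc-iut cell, block C / wave W6 cone prover abc-iut-w6-d013; node **IUTchII:Ex1.8(ix)**)
of abc-iut-L6-t1's statement file `Literature/IUT/HodgeArakelov/AbsTopInterfaces.lean` (p407495), which DEFINES
`AbsTopMonoids.unitsInvariants` (the `G`-invariants `O^×(G)^G`) and `AbsTopMonoids.logShell` (the log-shell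
`I(G)`). NO new definitions; nothing of the statement file is restated.

Source: S. Mochizuki, *Inter-universal Teichmüller theory II*, §1, Example 1.8 (ix), kurims manuscript (Dec. 2020)
p. 41: "Note that if `G` is a topological group isomorphic to `G_k`, then, in addition to `G ↷ O^×(G)`,
`G ↷ O^{×μ}(G)`, one may also construct the log-shell `I(G) ⊆ O^{×μ}(G)` [i.e., `p⁻¹` times the image of the
`G`-invariants of `O^×(G)` in `O^{×μ}(G)` — cf. [AbsTopIII], Proposition 5.8, (ii)]. In particular, if one
replaces the notation “`G ↷ O^{×μ}(G)`” in the discussion of (v), (vi), and (viii) by the notation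
“`(G ↷ O^{×μ}(G), I(G) ⊆ O^{×μ}(G))`” [i.e., “`G ↷ O^{×μ}(G)` equipped with its associated log-shell”], then one
verifies immediately that one obtains a “log-shell version” of the multiradial environments constructed in (v),
(vi), and (viii)." (claim key `Mochizuki2012`, status DISPUTED, D-0012; record-only, no side taken.)

What "one verifies immediately" amounts to, and what is PROVED here (pure group theory over the interface
`AbsTopMonoids`; the isomorphisms of coric data in (v), (vi), (viii) are "`Γ^{×μ}`-multiples of the isomorphism
`(G ↷ O^{×μ}(G)) ⥲ (G* ↷ O^{×μ}(G*))` induced by an isomorphism of topological groups `G ⥲ G*`", with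
`Γ^{×μ} ⊆ Ism(-)` a closed subgroup of the groups of `G`-isometries of Example 1.8 (iv), p. 39):
* dictionary with the Definition 4.9 (i) file `KummerStructures.lean` (abc-iut-L6-t2, p403748):
  `unitsInvariants_eq_fixedBy` (`O^×(G)^G = fixedBy (actOunits) ⊤`) and
  `image_unitsInvariants_eq_invariantLattice` (its image in `O^{×μ}(G)` is the lattice `invariantLattice _ ⊤`);
  `mem_logShell_iff_pow_mem_invariantLattice`; `one_mem_logShell`; the lattice lies in the log-shell
  (`image_unitsInvariants_subset_logShell`);
* TRANSPORT along isomorphisms induced by `G ⥲ G*` (functoriality of `(*⊳)`, field `mapOtri`): the induced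
  isomorphism of units carries `O^×(G)^G` onto `O^×(G*)^{G*}` (`image_unitsInvariants_mapOtri`) and its descent to
  `O^{×μ}` carries `I(G)` onto `I(G*)` (`image_logShell_mapOtri`);
* INVARIANCE under `G`-isometries: every automorphism of `O^{×μ}(G)` preserving the lattice `Im(O^×(G)^G)` — in
  particular every element of `Ism(G) = isometryGroup (actOunits G) 𝓗` for a family `𝓗` of open subgroups
  containing `G` itself — carries `I(G)` onto itself (`image_logShell_of_mem_isometryGroup`).
Hence equipping `G ↷ O^{×μ}(G)` with `I(G)` changes neither the coric nor the radial categories of (v), (vi),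
(viii) (graph of a functorial algorithm, Example 1.9 (i)), and the printed multiradiality of the "log-shell
versions" is the shape theorem `ex18iii_isMultiradial` of `RadialExamples.lean` (p406303), cited BY NAME, not
restated.
-/

namespace Literature.IUT.HodgeArakelov

namespace AbsTopMonoids

open CategoryTheory

universe u

variable {S : ThetaSetting.{u}} (A : AbsTopMonoids S)

/-! ### The `G`-invariants `O^×(G)^G` -/

/-- Membership in the `G`-invariants `O^×(G)^G` in terms of the action `actOunits` of `G` on the units
([IUTchII] Ex. 1.8 (ix), p. 41: "the `G`-invariants of `O^×(G)`").
[claim: Mochizuki2012, status: disputed] (IUTchII §1 Ex 1.8 (ix), kurims p.41) -/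
theorem mem_unitsInvariants_iff (G : IsoClass S.Gk) (u : A.Ounits G) :
    u ∈ A.unitsInvariants G ↔ ∀ g : G.G, A.actOunits G g u = u :=
  Iff.rfl

/-- Dictionary with [IUTchII] Def. 4.9 (i) (`KummerStructures.fixedBy`): `O^×(G)^G` is the subgroup of
invariants of the whole group `G` acting on `O^×(G)` through `actOunits`.
[claim: Mochizuki2012, status: disputed] (IUTchII §1 Ex 1.8 (ix), kurims p.41) -/
theorem unitsInvariants_eq_fixedBy (G : IsoClass S.Gk) :
    A.unitsInvariants G = (fixedBy (A.actOunits G) ⊤ : Subgroup (A.Ounits G)) := by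
  ext u
  simp only [mem_unitsInvariants_iff, SetLike.mem_coe, mem_fixedBy, Subgroup.mem_top, forall_const]

/-- `1 ∈ O^×(G)^G`. [claim: Mochizuki2012, status: disputed] (IUTchII §1 Ex 1.8 (ix), kurims p.41) -/
theorem one_mem_unitsInvariants (G : IsoClass S.Gk) : (1 : A.Ounits G) ∈ A.unitsInvariants G := by
  rw [unitsInvariants_eq_fixedBy]
  exact Subgroup.one_mem _

/-- `O^×(G)^G` is closed under multiplication.
[claim: Mochizuki2012, status: disputed] (IUTchII §1 Ex 1.8 (ix), kurims p.41) -/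
theorem mul_mem_unitsInvariants (G : IsoClass S.Gk) {u v : A.Ounits G} (hu : u ∈ A.unitsInvariants G)
    (hv : v ∈ A.unitsInvariants G) : u * v ∈ A.unitsInvariants G := by
  rw [unitsInvariants_eq_fixedBy] at hu hv ⊢
  exact Subgroup.mul_mem _ hu hv

/-- `O^×(G)^G` is closed under inversion.
[claim: Mochizuki2012, status: disputed] (IUTchII §1 Ex 1.8 (ix), kurims p.41) -/
theorem inv_mem_unitsInvariants (G : IsoClass S.Gk) {u : A.Ounits G} (hu : u ∈ A.unitsInvariants G) :
    u⁻¹ ∈ A.unitsInvariants G := by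
  rw [unitsInvariants_eq_fixedBy] at hu ⊢
  exact Subgroup.inv_mem _ hu

/-- Dictionary with [IUTchII] Def. 4.9 (i) / Ex. 1.8 (iv) (`KummerStructures.invariantLattice`): the image of
`O^×(G)^G` in `O^{×μ}(G)` is the lattice `Im(O^×(G)^G) ⊆ O^{×μ}(G)^G` determined by the invariants of `G` itself
(p. 39 "the «lattice» in `O^{×μ}(G)^H` determined by the image of `O^×(G)^H`", at `H = G`).
[claim: Mochizuki2012, status: disputed] (IUTchII §1 Ex 1.8 (ix), kurims p.41) -/
theorem image_unitsInvariants_eq_invariantLattice (G : IsoClass S.Gk) :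
    (QuotientGroup.mk : A.Ounits G → A.Oxmu G) '' A.unitsInvariants G =
      (invariantLattice (A.actOunits G) ⊤ : Subgroup (A.Oxmu G)) := by
  rw [unitsInvariants_eq_fixedBy, invariantLattice, Subgroup.coe_map]
  rfl

/-! ### The log-shell `I(G)` -/

/-- Unfolding of the log-shell: `y ∈ I(G)` iff `y^p` lies in the image of `O^×(G)^G` in `O^{×μ}(G)` ("`p⁻¹`
times the image of the `G`-invariants of `O^×(G)` in `O^{×μ}(G)`", p. 41).
[claim: Mochizuki2012, status: disputed] (IUTchII §1 Ex 1.8 (ix), kurims p.41) -/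
theorem mem_logShell_iff (G : IsoClass S.Gk) (y : A.Oxmu G) :
    y ∈ A.logShell G ↔
      y ^ S.p ∈ (QuotientGroup.mk : A.Ounits G → A.Oxmu G) '' A.unitsInvariants G :=
  Iff.rfl

/-- The log-shell in terms of the lattice of Def. 4.9 (i): `y ∈ I(G)` iff `y^p ∈ Im(O^×(G)^G)`.
[claim: Mochizuki2012, status: disputed] (IUTchII §1 Ex 1.8 (ix), kurims p.41) -/
theorem mem_logShell_iff_pow_mem_invariantLattice (G : IsoClass S.Gk) (y : A.Oxmu G) :
    y ∈ A.logShell G ↔ y ^ S.p ∈ (invariantLattice (A.actOunits G) ⊤ : Subgroup (A.Oxmu G)) := by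
  rw [mem_logShell_iff, image_unitsInvariants_eq_invariantLattice, SetLike.mem_coe]

/-- `1 ∈ I(G)`: the log-shell is non-empty. [claim: Mochizuki2012, status: disputed] (IUTchII §1 Ex 1.8 (ix), kurims p.41) -/
theorem one_mem_logShell (G : IsoClass S.Gk) : (1 : A.Oxmu G) ∈ A.logShell G := by
  rw [mem_logShell_iff_pow_mem_invariantLattice, one_pow]
  exact Subgroup.one_mem _

/-- The lattice `Im(O^×(G)^G)` lies in the log-shell `I(G) = p⁻¹ · Im(O^×(G)^G)` (a subgroup is closed under
`p`-th powers). [claim: Mochizuki2012, status: disputed] (IUTchII §1 Ex 1.8 (ix), kurims p.41) -/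
theorem image_unitsInvariants_subset_logShell (G : IsoClass S.Gk) :
    (QuotientGroup.mk : A.Ounits G → A.Oxmu G) '' A.unitsInvariants G ⊆ A.logShell G := by
  intro y hy
  rw [image_unitsInvariants_eq_invariantLattice, SetLike.mem_coe] at hy
  rw [mem_logShell_iff_pow_mem_invariantLattice]
  exact Subgroup.pow_mem _ hy _

/-- The log-shell `I(G)` is closed under inversion (it is the preimage of the subgroup `Im(O^×(G)^G)` under the
homomorphism `y ↦ y^p` of the commutative group `O^{×μ}(G)`).
[claim: Mochizuki2012, status: disputed] (IUTchII §1 Ex 1.8 (ix), kurims p.41) -/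
theorem inv_mem_logShell (G : IsoClass S.Gk) {y : A.Oxmu G} (hy : y ∈ A.logShell G) :
    y⁻¹ ∈ A.logShell G := by
  rw [mem_logShell_iff_pow_mem_invariantLattice] at hy ⊢
  rw [inv_pow]
  exact Subgroup.inv_mem _ hy

/-- The log-shell `I(G)` is closed under multiplication (same reason: `O^{×μ}(G)` is commutative, so
`(y z)^p = y^p z^p`). [claim: Mochizuki2012, status: disputed] (IUTchII §1 Ex 1.8 (ix), kurims p.41) -/
theorem mul_mem_logShell (G : IsoClass S.Gk) {y z : A.Oxmu G} (hy : y ∈ A.logShell G)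
    (hz : z ∈ A.logShell G) : y * z ∈ A.logShell G := by
  rw [mem_logShell_iff_pow_mem_invariantLattice] at hy hz ⊢
  rw [mul_pow]
  exact Subgroup.mul_mem _ hy hz

/-! ### Transport along isomorphisms induced by `G ⥲ G*` -/

/-- Equivariance of the induced isomorphism of units: for `f : G ⟶ G*` (an isomorphism of topological groups)
the isomorphism `O^×(G) ⥲ O^×(G*)` induced by `(*⊳)` intertwines the actions along `f` (from the interface law
`mapOtri_equivariant`; p. 38 "the isomorphism … `(G ↷ O^×(G)) ⥲ (G* ↷ O^×(G*))` induced by an isomorphism of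
topological groups `G ⥲ G*`"). [claim: Mochizuki2012, status: disputed] (IUTchII §1 Ex 1.8 (iii), kurims p.38) -/
theorem mapEquiv_mapOtri_actOunits {G H : IsoClass S.Gk} (f : G ⟶ H) (g : G.G) (u : A.Ounits G) :
    Units.mapEquiv (A.mapOtri f) (A.actOunits G g u) =
      A.actOunits H (IsoClass.homIso f g) (Units.mapEquiv (A.mapOtri f) u) := by
  ext
  exact A.mapOtri_equivariant f g (u : A.Otri G)

/-- TRANSPORT of invariants: the induced isomorphism `O^×(G) ⥲ O^×(G*)` identifies membership in `O^×(G)^G` and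
in `O^×(G*)^{G*}`. [claim: Mochizuki2012, status: disputed] (IUTchII §1 Ex 1.8 (ix), kurims p.41) -/
theorem mapEquiv_mapOtri_mem_unitsInvariants_iff {G H : IsoClass S.Gk} (f : G ⟶ H) (u : A.Ounits G) :
    Units.mapEquiv (A.mapOtri f) u ∈ A.unitsInvariants H ↔ u ∈ A.unitsInvariants G := by
  simp only [mem_unitsInvariants_iff]
  constructor
  · intro hH g
    have h := hH (IsoClass.homIso f g)
    rw [← mapEquiv_mapOtri_actOunits] at h
    exact (Units.mapEquiv (A.mapOtri f)).injective h
  · intro hG h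
    obtain ⟨g, rfl⟩ : ∃ g : G.G, IsoClass.homIso f g = h :=
      ⟨(IsoClass.homIso f).symm h, ContinuousMulEquiv.apply_symm_apply _ _⟩
    rw [← mapEquiv_mapOtri_actOunits, hG g]

/-- TRANSPORT of invariants (image form): `O^×(G)^G` is carried ONTO `O^×(G*)^{G*}`.
[claim: Mochizuki2012, status: disputed] (IUTchII §1 Ex 1.8 (ix), kurims p.41) -/
theorem image_unitsInvariants_mapOtri {G H : IsoClass S.Gk} (f : G ⟶ H) :
    Units.mapEquiv (A.mapOtri f) '' A.unitsInvariants G = A.unitsInvariants H := by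
  ext v
  constructor
  · rintro ⟨u, hu, rfl⟩
    exact (A.mapEquiv_mapOtri_mem_unitsInvariants_iff f u).2 hu
  · intro hv
    refine ⟨(Units.mapEquiv (A.mapOtri f)).symm v, ?_, MulEquiv.apply_symm_apply _ _⟩
    rw [← A.mapEquiv_mapOtri_mem_unitsInvariants_iff f, MulEquiv.apply_symm_apply]
    exact hv

/-- TRANSPORT of invariants (subgroup form, Def. 4.9 (i) dictionary).
[claim: Mochizuki2012, status: disputed] (IUTchII §1 Ex 1.8 (ix), kurims p.41) -/
theorem map_fixedBy_top_mapOtri {G H : IsoClass S.Gk} (f : G ⟶ H) :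
    (fixedBy (A.actOunits G) ⊤).map (Units.mapEquiv (A.mapOtri f)).toMonoidHom =
      fixedBy (A.actOunits H) ⊤ := by
  apply SetLike.coe_injective
  rw [Subgroup.coe_map, MulEquiv.coe_toMonoidHom, ← unitsInvariants_eq_fixedBy, ← unitsInvariants_eq_fixedBy]
  exact A.image_unitsInvariants_mapOtri f

/-- TRANSPORT of the lattice: the descent `O^{×μ}(G) ⥲ O^{×μ}(G*)` of the induced isomorphism of units
(`MulEquivModTorsion`, torsion being characteristic) carries `Im(O^×(G)^G)` onto `Im(O^×(G*)^{G*})`.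
[claim: Mochizuki2012, status: disputed] (IUTchII §1 Ex 1.8 (ix), kurims p.41) -/
theorem map_invariantLattice_top_mapOtri {G H : IsoClass S.Gk} (f : G ⟶ H) :
    (invariantLattice (A.actOunits G) ⊤).map
        (MulEquivModTorsion (Units.mapEquiv (A.mapOtri f))).toMonoidHom =
      invariantLattice (A.actOunits H) ⊤ := by
  have hcomp :
      (MulEquivModTorsion (Units.mapEquiv (A.mapOtri f))).toMonoidHom.comp
          (QuotientGroup.mk' (CommGroup.torsion (A.Ounits G))) =
        (QuotientGroup.mk' (CommGroup.torsion (A.Ounits H))).comp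
          (Units.mapEquiv (A.mapOtri f)).toMonoidHom := by
    ext u
    simp only [MonoidHom.coe_comp, MulEquiv.coe_toMonoidHom, Function.comp_apply, QuotientGroup.mk'_apply,
      mulEquivModTorsion_mk]
  rw [invariantLattice, invariantLattice, Subgroup.map_map, hcomp, ← Subgroup.map_map,
    map_fixedBy_top_mapOtri]

/-- TRANSPORT of the log-shell (membership form): the induced isomorphism `O^{×μ}(G) ⥲ O^{×μ}(G*)` identifies
membership in `I(G)` and in `I(G*)` — the isomorphisms of coric data of (v), (vi), (viii) induced by `G ⥲ G*`
are automatically compatible with the log-shells ("one verifies immediately", p. 41).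
[claim: Mochizuki2012, status: disputed] (IUTchII §1 Ex 1.8 (ix), kurims p.41) -/
theorem mulEquivModTorsion_mapOtri_mem_logShell_iff {G H : IsoClass S.Gk} (f : G ⟶ H) (y : A.Oxmu G) :
    MulEquivModTorsion (Units.mapEquiv (A.mapOtri f)) y ∈ A.logShell H ↔ y ∈ A.logShell G := by
  rw [mem_logShell_iff_pow_mem_invariantLattice, mem_logShell_iff_pow_mem_invariantLattice, ← map_pow,
    ← A.map_invariantLattice_top_mapOtri f, Subgroup.mem_map_equiv, MulEquiv.symm_apply_apply]

/-- TRANSPORT of the log-shell (image form): `I(G)` is carried ONTO `I(G*)` by the isomorphism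
`O^{×μ}(G) ⥲ O^{×μ}(G*)` induced by any `f : G ⟶ G*` — the "log-shell version" assignment
`G ↦ (G ↷ O^{×μ}(G), I(G) ⊆ O^{×μ}(G))` is functorial in isomorphisms of topological groups.
[claim: Mochizuki2012, status: disputed] (IUTchII §1 Ex 1.8 (ix), kurims p.41) -/
theorem image_logShell_mapOtri {G H : IsoClass S.Gk} (f : G ⟶ H) :
    MulEquivModTorsion (Units.mapEquiv (A.mapOtri f)) '' A.logShell G = A.logShell H := by
  ext z
  constructor
  · rintro ⟨y, hy, rfl⟩
    exact (A.mulEquivModTorsion_mapOtri_mem_logShell_iff f y).2 hy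
  · intro hz
    refine ⟨(MulEquivModTorsion (Units.mapEquiv (A.mapOtri f))).symm z, ?_, MulEquiv.apply_symm_apply _ _⟩
    rw [← A.mulEquivModTorsion_mapOtri_mem_logShell_iff f, MulEquiv.apply_symm_apply]
    exact hz

/-! ### Invariance under `G`-isometries (`Γ^{×μ} ⊆ Ism(G)`-multiples) -/

/-- An automorphism of `O^{×μ}(G)` preserving the lattice `Im(O^×(G)^G)` identifies membership in `I(G)` before
and after. [claim: Mochizuki2012, status: disputed] (IUTchII §1 Ex 1.8 (ix), kurims p.41) -/
theorem mem_logShell_iff_of_map_invariantLattice (G : IsoClass S.Gk) (φ : MulAut (A.Oxmu G))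
    (hφ : (invariantLattice (A.actOunits G) ⊤).map φ.toMonoidHom = invariantLattice (A.actOunits G) ⊤)
    (y : A.Oxmu G) : φ y ∈ A.logShell G ↔ y ∈ A.logShell G := by
  rw [mem_logShell_iff_pow_mem_invariantLattice, mem_logShell_iff_pow_mem_invariantLattice, ← map_pow]
  conv_lhs => rw [← hφ]
  rw [Subgroup.mem_map_equiv, MulEquiv.symm_apply_apply]

/-- An automorphism of `O^{×μ}(G)` preserving the lattice `Im(O^×(G)^G)` carries the log-shell `I(G)` ONTO
itself. [claim: Mochizuki2012, status: disputed] (IUTchII §1 Ex 1.8 (ix), kurims p.41) -/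
theorem image_logShell_of_map_invariantLattice (G : IsoClass S.Gk) (φ : MulAut (A.Oxmu G))
    (hφ : (invariantLattice (A.actOunits G) ⊤).map φ.toMonoidHom = invariantLattice (A.actOunits G) ⊤) :
    φ '' A.logShell G = A.logShell G := by
  ext z
  constructor
  · rintro ⟨y, hy, rfl⟩
    exact (A.mem_logShell_iff_of_map_invariantLattice G φ hφ y).2 hy
  · intro hz
    refine ⟨φ.symm z, ?_, MulEquiv.apply_symm_apply _ _⟩
    rw [← A.mem_logShell_iff_of_map_invariantLattice G φ hφ, MulEquiv.apply_symm_apply]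
    exact hz

/-- INVARIANCE under `G`-isometries ([IUTchII] Ex. 1.8 (iv), p. 39: `Ism(G)` = "`G`-equivariant automorphisms
of … `O^{×μ}(G)` that, for each open subgroup `H ⊆ G`, preserve the «lattice» in `O^{×μ}(G)^H` determined by
the image of `O^×(G)^H`", typed as `isometryGroup` in the Def. 4.9 (i) file): for any family `𝓗` of subgroups
containing `G` itself (an open subgroup), every `G`-isometry carries `I(G)` onto itself — so the
`Γ^{×μ}`-multiples (`Γ^{×μ} ⊆ Ism(G)`) of induced isomorphisms in (v), (vi), (viii) respect the log-shells.
[claim: Mochizuki2012, status: disputed] (IUTchII §1 Ex 1.8 (ix), kurims p.41) -/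
theorem image_logShell_of_mem_isometryGroup (G : IsoClass S.Gk) {𝓗 : Set (Subgroup G.G)} (hG : ⊤ ∈ 𝓗)
    {φ : MulAut (A.Oxmu G)} (hφ : φ ∈ isometryGroup (A.actOunits G) 𝓗) :
    φ '' A.logShell G = A.logShell G :=
  A.image_logShell_of_map_invariantLattice G φ (((mem_isometryGroup _ _ φ).1 hφ).2 ⊤ hG)

/-- The composite case used by the coric isomorphisms of the "log-shell versions" of (v), (vi), (viii): a
`G*`-isometry `φ` (lattice-preserving at `G*` itself) composed with the isomorphism induced by `f : G ⟶ G*`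
carries `I(G)` onto `I(G*)`. [claim: Mochizuki2012, status: disputed] (IUTchII §1 Ex 1.8 (ix), kurims p.41) -/
theorem image_logShell_isometry_comp_mapOtri {G H : IsoClass S.Gk} (f : G ⟶ H) (φ : MulAut (A.Oxmu H))
    (hφ : (invariantLattice (A.actOunits H) ⊤).map φ.toMonoidHom = invariantLattice (A.actOunits H) ⊤) :
    (fun y => φ (MulEquivModTorsion (Units.mapEquiv (A.mapOtri f)) y)) '' A.logShell G = A.logShell H := by
  rw [← Set.image_image (g := fun z => φ z), A.image_logShell_mapOtri f]
  exact A.image_logShell_of_map_invariantLattice H φ hφ
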